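import Mathlib
import Literature.Probability.LatticeModels.PairIsing
import Summits.CriticalPhenomena.Ising3DConformalLimit.Theses.LocalisationClock

/-!
# Sketch — crux-ideate (ideator 2, round 1) for `LocalisationGHS` (stmt-CriticalPhenomena-15882)

First lemmas of the idea card `annealed-leaf-domination`, plus the TYPED NEGATIVE produced by
this session's falsifier (the exact-revelation germ), stated over existing declarations only
(`Literature.Probability.LatticeModels.PairIsing.gibbsAvg`, `spinAt`, `SpinConfig`; Mathlib measures).
Nothing is proved here; the file only has to ELABORATE (`lean check` rc 0).

* `TwoFieldLebowitzCov` — Percus–Lebowitz two-field comparison (first lemma, provable now).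
* `DominationMonotone` — its consequence for the crux's own functionals: along the domination
  order of data `y ≽ y'` (i.e. `y_a ≥ |y'_a|` on the block) the clock rate `r` decreases and the
  squared polarisation `m²` increases (the card's lever, provable from the first lemma + GKS/FKG).
* `LeafMagnitudeCov` — the outer piece of the exact rectification split (true for the planted
  magnitude law in every computed cell; FALSE for skewed product laws — law-sensitive).
* `RevealedBlockGHS` — the exact-revelation germ; numerically true in > 4·10⁵ small cases but
  REFUTED in general by this session (rigid-cluster geometries, see evidence `sharpness-report.md`);
  kept here as the typed form of that negative knowledge.
-/

noncomputable section

namespace Summit.CriticalPhenomena.Ising3DConformalLimit.Cruxes.LocalisationGHS.Sketch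

open scoped BigOperators
open Classical MeasureTheory
open Literature.Probability.LatticeModels

/-- **Two-field Lebowitz comparison** (Percus duplicate variables; Lebowitz 1974 run with the two
copies in fields `h` and `h'`, `|h'| ≤ h` sitewise, so that `t = σ + σ'` sees the field `h + h' ≥ 0`
and `q = σ - σ'` the field `h - h' ≥ 0`; then `⟨t_a q_b⟩ - ⟨t_a⟩⟨q_b⟩ ≤ 0` reads): truncated pair
correlations are smaller in the dominating field, `Cov_h(σ_a, σ_b) ≤ Cov_{h'}(σ_a, σ_b)`.
The equal-field case is in tree (`lebowitz_pair`, `lebowitz_prod`, Glimm–Jaffe Cor. 4.3.2). -/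
def TwoFieldLebowitzCov : Prop :=
  ∀ (n : ℕ) (c : Fin n → Fin n → ℝ) (h h' : Fin n → ℝ) (a b : Fin n),
    (∀ x y, 0 ≤ c x y) → (∀ x, |h' x| ≤ h x) →
    let avg : (Fin n → ℝ) → (SpinConfig (Fin n) → ℝ) → ℝ := fun g F =>
      PairIsing.gibbsAvg c (fun σ => F σ * Real.exp (∑ x, g x * spinAt x σ)) /
        PairIsing.gibbsAvg c (fun σ => Real.exp (∑ x, g x * spinAt x σ))
    avg h (fun σ => spinAt a σ * spinAt b σ) - avg h (fun σ => spinAt a σ) * avg h (fun σ => spinAt b σ) ≤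
      avg h' (fun σ => spinAt a σ * spinAt b σ) - avg h' (fun σ => spinAt a σ) * avg h' (fun σ => spinAt b σ)

/-- **Domination monotonicity of the clock functionals** (the card's lever, in the crux's own
telescope): for data `y ≽ y'` on the block (`y_a ≥ |y'_a|` for observed `a`, both `0` off the block)
the clock rate is smaller and the squared polarisation larger at `y`:
`r(y) ≤ r(y')` and `m(y')² ≤ m(y)²`. From `TwoFieldLebowitzCov` (each `A_a` decreases),
FKG (`A_a ≥ 0`) and two-field GKS (`m(y) ≥ |m(y')|`). -/
def DominationMonotone : Prop :=
  ∀ (n : ℕ) (c : Fin n → Fin n → ℝ) (e : Fin n → Bool) (y y' : Fin n → ℝ),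
    (∀ a b, 0 ≤ c a b) → (∀ a, e a = true → |y' a| ≤ y a) →
    (∀ a, e a = false → y a = 0 ∧ y' a = 0) →
    let tilt : (Fin n → ℝ) → (SpinConfig (Fin n) → ℝ) → ℝ := fun z g =>
      PairIsing.gibbsAvg c (fun σ => g σ * Real.exp (∑ a, z a * spinAt a σ)) /
        PairIsing.gibbsAvg c (fun σ => Real.exp (∑ a, z a * spinAt a σ))
    let blk : SpinConfig (Fin n) → ℝ := fun σ => ∑ a, if e a then spinAt a σ else 0
    let m : (Fin n → ℝ) → ℝ := fun z => tilt z blk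
    let Af : (Fin n → ℝ) → Fin n → ℝ := fun z a =>
      tilt z (fun σ => spinAt a σ * blk σ) - tilt z (fun σ => spinAt a σ) * m z
    let r : (Fin n → ℝ) → ℝ := fun z => ∑ a, if e a then Af z a ^ 2 else 0
    r y ≤ r y' ∧ m y' ^ 2 ≤ m y ^ 2

/-- **(MagCov) — outer piece of the exact rectification split.** For the leaf-augmented zero-field
pair ferromagnet `G_u` (one leaf per block site `a`, coupled to `a` with coupling `u_a ≥ 0`; written
here by putting the field `ε ⊙ u` on the block and summing over the leaf signs `ε` with their Gibbs
weights), let `φ(u) = E_{G_u}[∑_a Cov(σ_a, M_e | ε)²]` and `ψ(u) = E_{G_u}[E[M_e | ε]²]`. Under the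
iid magnitude law `w_s(du) ∝ 𝟙_{u ≥ 0} e^{-u²/(2s)} cosh(u) du` (the law of `|y_a|` for the planted
channel at SNR `s`), `Cov(φ, ψ) ≤ 0`. Written with the unnormalised weight (scale-free).
Numerics: `≤ 0` in 160/160 planted cells; FALSE for skewed two-point product laws (the specific
folded-Gaussian law is load-bearing). -/
def LeafMagnitudeCov : Prop :=
  ∀ (n : ℕ) (c : Fin n → Fin n → ℝ) (e : Fin n → Bool) (s : ℝ), (∀ x y, 0 ≤ c x y) → 0 < s →
    let blk : SpinConfig (Fin n) → ℝ := fun σ => ∑ x, if e x then spinAt x σ else 0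
    let tilt : (Fin n → ℝ) → (SpinConfig (Fin n) → ℝ) → ℝ := fun y g =>
      PairIsing.gibbsAvg c (fun σ => g σ * Real.exp (∑ x, y x * spinAt x σ)) /
        PairIsing.gibbsAvg c (fun σ => Real.exp (∑ x, y x * spinAt x σ))
    let fld : (Fin n → ℝ) → (Fin n → Bool) → (Fin n → ℝ) := fun u ε x =>
      if e x then (if ε x then u x else -u x) else 0
    -- relative Gibbs weight of the leaf-sign pattern `ε` at magnitudes `u`: Z(ε ⊙ u)/Z(0)
    let wt : (Fin n → ℝ) → (Fin n → Bool) → ℝ := fun u ε =>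
      PairIsing.gibbsAvg c (fun σ => Real.exp (∑ x, fld u ε x * spinAt x σ))
    let X : (Fin n → ℝ) → (Fin n → Bool) → ℝ := fun u ε => tilt (fld u ε) blk
    let A : (Fin n → ℝ) → (Fin n → Bool) → Fin n → ℝ := fun u ε a =>
      tilt (fld u ε) (fun σ => spinAt a σ * blk σ) - tilt (fld u ε) (fun σ => spinAt a σ) * X u ε
    let φ : (Fin n → ℝ) → ℝ := fun u =>
      (∑ ε : Fin n → Bool, wt u ε * ∑ a, if e a then A u ε a ^ 2 else 0) / ∑ ε : Fin n → Bool, wt u ε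
    let ψ : (Fin n → ℝ) → ℝ := fun u => (∑ ε : Fin n → Bool, wt u ε * X u ε ^ 2) / ∑ ε : Fin n → Bool, wt u ε
    let dens : ℝ → ℝ := fun t => if 0 ≤ t then Real.exp (-t ^ 2 / (2 * s)) * Real.cosh t else 0
    let μ : Measure (Fin n → ℝ) :=
      Measure.pi fun _ : Fin n => (volume : Measure ℝ).withDensity fun t => ENNReal.ofReal (dens t)
    (∫ u, φ u * ψ u ∂μ) * (∫ _u, (1 : ℝ) ∂μ) ≤ (∫ u, φ u ∂μ) * (∫ u, ψ u ∂μ)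

/-- **Exact-revelation germ (TYPED NEGATIVE).** For a finite zero-field pair ferromagnet `c ≥ 0`, a
block `e`, a set `L` of exactly revealed sites and a block site `a ∉ L`, with `X(σ) = E[M_e | σ_L]`
and `A(σ) = Cov(σ_a, M_e | σ_L)`: `⟨X² A²⟩_c ≤ ⟨X²⟩_c ⟨A²⟩_c`. TRUE for `|L| ≤ 2` (two-field
Lebowitz) and in every one of ~4·10⁵ enumerated cases with `n ≤ 7`, but FALSE in general: on the
26-site geometry "light probe + strongly coupled light pendant + three rigid 8-clusters" with the
pendant and the clusters revealed it is `+5%` (rigid limit computed exactly via weighted super-spins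
`f = (1,8,8,8,1)`; `+19%` at `(1,33,33,33,3)`). Any proof of the crux therefore has to use the
SOFTNESS of Gaussian side-information; no inequality stable under exact conditioning on block
spins implies `LocalisationGHS`. -/
def RevealedBlockGHS : Prop :=
  ∀ (n : ℕ) (c : Fin n → Fin n → ℝ) (e : Fin n → Bool) (L : Finset (Fin n)) (a : Fin n),
    (∀ x y, 0 ≤ c x y) → e a = true → a ∉ L →
    let blk : SpinConfig (Fin n) → ℝ := fun σ => ∑ x, if e x then spinAt x σ else 0
    let ind : SpinConfig (Fin n) → SpinConfig (Fin n) → ℝ :=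
      fun σ ρ => if (∀ x ∈ L, ρ x = σ x) then 1 else 0
    let ce : (SpinConfig (Fin n) → ℝ) → SpinConfig (Fin n) → ℝ := fun g σ =>
      PairIsing.gibbsAvg c (fun ρ => g ρ * ind σ ρ) / PairIsing.gibbsAvg c (ind σ)
    let X : SpinConfig (Fin n) → ℝ := ce blk
    let A : SpinConfig (Fin n) → ℝ := fun σ =>
      ce (fun ρ => spinAt a ρ * blk ρ) σ - ce (fun ρ => spinAt a ρ) σ * X σ
    PairIsing.gibbsAvg c (fun σ => X σ ^ 2 * A σ ^ 2) ≤
      PairIsing.gibbsAvg c (fun σ => X σ ^ 2) * PairIsing.gibbsAvg c (fun σ => A σ ^ 2)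

/-- The card's composition target, for the record (NOT a claim that the two named pieces suffice
alone — the inner leaf germ is only claimed on average over the iid magnitudes, see the card):
`TwoFieldLebowitzCov → DominationMonotone` is the provable spine; the crux is its FKG-average. -/
def Spine : Prop :=
  TwoFieldLebowitzCov → DominationMonotone

end Summit.CriticalPhenomena.Ising3DConformalLimit.Cruxes.LocalisationGHS.Sketch

end
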